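import Summits.QuantumFields.BalabanUV.T4Continuum.Spine.NE7.Targets

/-!
# BalabanUVNodes ∕ N19′ (NE7-proper core face of K3⁷ v5 stub 2) — NO DIAL RESCUES A LAW-SEPARATED PAIR:
# the `lt_one`-free, unbundled, LAW-SEPARATION edition of the across-class merge forced by the three faces of `stub_expansion13H`

Cell `pub-ymgap` (HUMAN RULING D-0062 Track A; D-0154 width push R399 (3a)), seat `pub-ymgap-dag-n19-w4` (WIDTH SEAT 4 on NODE n19 = NE7) gen 3,
CLAIM-1 ∕ INTENT-1 (pub-ymgap INBOX l.29600).  Filed `--kind proof --supports stmt-QuantumFields-20544 --as helper` (K3⁷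
`Summit.QuantumFields.YangMills.Theses.BalabanUVNodes.SpineGivenEndpointR13SepCoPH`, skeleton of record v5 941dddb108cbaacf); COUNT-NEUTRAL.
THEOREMS ONLY: no `def`, no `instance`, no `notation`, no `sorry`, no private decls.

WHAT THIS IS.  The crux idea card `window-key-core` EDITION 2 (ym-nodeO idea-3 g9; `Cruxes/SpineGivenEndpointR13SepCoPH/Ideas/window-key-core.md` 2b05d3030257, kernel
`Cruxes/SpineGivenEndpointR13SepCoPH/WindowKeyCoreLawMergeSketch.lean` = «Sketch3», evidence n°56∕57 on stmt-QuantumFields-20544, 2026-08-28T05:2xZ) offers its §1–§4 as item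
**P4 «support, kernel — liftable verbatim into `Theorems/` by any n19∕n20∕n21 width seat»**, and the crux critic's sheet `CRIT-1-TRIAGE-window-key-core-ed2.md` (ym-nodeO
CRIT-1 g4) recommends exactly that (Rec. (a)).  A `Theorems∕` file cannot import `Cruxes∕`; this file IS that lift, with the sketch's four `def`s (`classLaw`, `slope`, `rho`,
`LawSeparated`) SPELLED INLINE so the file stays definition-free, the theorem NAMES kept so the card and the triage sheets resolve by name, and one positive-form
corollary added (`lawMerge_of_faces`).

SETTING = the SHAPES K3⁷ v5 stub 2 `stub_expansion13H` conjoins at the carriers pinned by `PinnedAtLive` (index family `T`, run-A ∕ run-B class weights `A`, `B` —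
dial-free by `Theorems/BalabanUVNodesSpineReadingOfRecord13CoPHV` :83–:93, all `rfl`), with every letter the two dials `jc : CutReading`, `sh : ShellSplit₁₃CoPH 2 0` can
move — the bad class `Bad`, its weight `W`, the shells `shA shB`, their weight `Wsh` — and the existential radius `δ` FREE: the three faces are
`T4WeightBudget.RelWeightBound l₀ T A B Bad W` (head of `KeyedRelWeight`), `T4IndicatorShell.ShellWeightBound l₀ T A B shA shB Wsh` (head of `KeyedShellWeight`) and
`∃ δ, Spine.NE7.Core l₀ vol T Bad (A − shA) (B − shB) δ ∧ Summable δ` (body of `KeyedCoreEdgeHolderD4`).  NO `lt_one` letter is among them.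

WHAT IS PROVED ([folklore] finite-sum ∕ `exp` arithmetic on those hypothesis SHAPES).
* §1 `setSum_sandwich` — the three faces at ONE step `K` ⇒ ONE constant `c` with, for every `|t| ≤ l₀` and EVERY class set `S ⊆ T K`,
  `Σ_S B ≤ e^{c+vol·δ_K}·Σ_S A + (W_K + Wsh_K)·Σ_T B` and `Σ_S A ≤ e^{−c+vol·δ_K}·Σ_S B + (W_K + Wsh_K)·Σ_T A` — whatever `Bad`, whatever the shells.
* §2 `classLaw_le_of_faces` — single-step AFFINE DOMINATION of the normalised class laws `μ_X(S) := Σ_S X ∕ Σ_{T K} X`: with `ε_K := W_K + Wsh_K < 1` AT THAT `K` and a positive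
  run-A total, `μ_B(S) ≤ M_K·μ_A(S) + ε_K`, `μ_A(S) ≤ M_K·μ_B(S) + ε_K`, `M_K := e^{2|vol·δ_K|} ∕ (1 − ε_K)`, and the run-B total is positive; `abs_classLaw_sub_le_of_faces` —
  `|μ_B(S) − μ_A(S)| ≤ ρ_K := (M_K − 1) + ε_K`; `tendsto_rho` — `ρ_K → 0` from the three summabilities the faces THEMSELVES carry; ★ `lawMerge_of_faces` — hence the two runs'
  class laws MERGE uniformly in `(t, S)`: `∀ s > 0, ∀ᶠ K, ∀ |t| ≤ l₀, ∀ S ⊆ T K, |μ_B(S) − μ_A(S)| < s`.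
* §3 ★★ `no_dial_rescues` — LAW SEPARATION (LS) at size `s > 0` («for every `K₀` some `K ≥ K₀`, `|t| ≤ l₀`, `S ⊆ T K` with `μ_B(S) − μ_A(S) ≥ s`») and positive run-A totals ⇒
  `¬ ∃ Bad W shA shB Wsh δ, RelWeightBound ∧ ShellWeightBound ∧ (Core ∧ Summable δ)` — ALL SIX letters existential, NO `lt_one`; `not_hybridNE7_of_lawSeparated` — the same for
  `T4MatchingAssembly.HybridNE7`; `separation_le_rho` — the quantitative one-step handle (a producer of the faces with rates `(δ, W, Wsh)` is refuted by ONE `(K, t, S)` with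
  `μ_B(S) − μ_A(S) > ρ_K`).
* §4 toys (two classes `Bool`, `A_K ≡ 4^K`, `B_K = 4^K·(6, 2)`, spelled inline): `toy_lawSeparated` (`s = 1∕4`) · `toy_no_dial` (NON-VACUITY of §3: no dial delivers the faces) ·
  `toy_target` (node U5's DECL target `Spine.NE7.Target vol l₀ 0 Z` holds EXACTLY at `Z_K = 2·4^K` — the target lives while no hybrid certificate exists, as in dag-n19-w1's
  `…N19HybridBeyondTarget` (p602850) «the hybrid road asks MORE than the target»).

ADJACENT TREE THEOREMS, CITED BY NAME, NOT RESTATED (pub-ymgap DEDUP-382 «later INTENT cites the earlier»).  dag-n20-w4 `Theorems/BalabanUVNodesN20HybridClassLawBudget`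
(p607565) is the BUNDLED edition: under `h : HybridNE7 …` (whose `lt_one` field gives `W_K + Wsh_K < 1` at EVERY `K`) its `abs_classLaw_sub_classLaw_le_of_hybridNE7` bounds
`|μ_A(S) − μ_B(S)|` by the LINEAR budget `2(W_K + Wsh_K) + 2|vol·δ_K|` (a better constant than `ρ_K` here), `not_exists_hybridNE7_of_unsummable_classLawGap` kills `HybridNE7` for all
six dials from an unsummable exhibited gap, and `not_coreEdge_of_unsummable_classLawGap` kills the `∃ δ` core edge at FIXED admissible `Bad ∕ W ∕ shA ∕ shB ∕ Wsh` with `W + Wsh < 1`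
∀ `K`.  THIS file's §3 is the complementary packaging the disprover's letter needs (CRIT-1 ed-2 item 4: `stub2_false_of_H` with H = a cofinal tuned family carrying (LS)): the v5
face TRIPLE itself (no `lt_one`; `W_K + Wsh_K < 1` only EVENTUALLY, from summability), all six letters existential at once, hypothesis in (LS) form; its §2 is the single-`(K, t)`
affine form needing `ε_K < 1` at that step only.  dag-n20-w5 `…N20QuantisedRatioNoRescue` (p606977: the binders PAY the misfit — necessity) and dag-n19-w1 p602850 §6
`not_coreEdge_of_unsummable_gap` (two good classes, weights AND shells fixed) are the other neighbours; dag-n19-c ∕ dag-n19-w2's `…N19CoreTVInvariant` ∕ `…N19TVProductBlocks` are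
WITHIN-class total variation on common class spaces — a different object (this file's laws live on the class INDEX `T K`).

WHAT IS NOT PROVED ∕ HONEST FRAMING.  Whether the record's two across-class laws (`classSet₁₃`, `weightA₁₃`, `weightB₁₃` at `K₀ = 0`, tuned `g₀`) SEPARATE — the card's letter N1
(LS), CRIT-1 ed-2 item 4 — is NOT decided here and is the disprover's; so this file REFUTES NOTHING: not stub 2, not the crux, no `Negative/` lemma.  It proves NO estimate of the
programme; nothing of Bałaban's is asserted, read off a datum or instantiated (A6: no antecedent mentions a Bałaban object; A2: hypotheses are the tree's shapes as letters, §4 shows the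
§3 hypothesis set inhabited).  NE7 ∕ NE7b ∕ NE7c are NOT PRINTED for `d = 4` and NOT proved; N19 ∕ N20 ∕ N21 NOT discharged; K3⁷ OPEN, not claimed; counts unmoved (typed 28∕28 ·
discharged 5∕27); no count claim; no summit statement is proved by this seat.  One finite `𝕋⁴` programme at fixed `ε`, Bałaban AS PRINTED; R4 closes the CONDITIONAL finite-𝕋⁴ rung
`BalabanLadder.UV` only — NOT ℝ⁴, NOT continuum, NOT OS; the Yang–Mills mass gap (Clay) is NOT proved by any of this; [Balaban1988Convergent] Thm 2 (CMP 109 p.259) unproved in print.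
Sources (location only): [Balaban1989LargeFieldII] (1.79)–(1.83) pp.384–385; [Balaban1988Convergent] (1.1) p.244 L20–29.
-/

open Finset Filter Topology
open Literature.MathematicalPhysics.QuantumFieldTheory.Balaban1983to89
open Literature.MathematicalPhysics.QuantumFieldTheory.Balaban1983to89.T4CauchySum
open Literature.MathematicalPhysics.QuantumFieldTheory.Balaban1983to89.T4WeightBudget
open Literature.MathematicalPhysics.QuantumFieldTheory.Balaban1983to89.T4IndicatorShell
open Literature.MathematicalPhysics.QuantumFieldTheory.Balaban1983to89.T4MatchingAssembly
open Summit.QuantumFields.BalabanUV.T4Continuum.Spine.NE7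

namespace Summit.QuantumFields.YangMills.BalabanUVNodes.N19NoDialRescuesLawSeparated

variable {ι : Type*} [DecidableEq ι] {l₀ vol : ℝ} {T : ℕ → Finset ι} {A B shA shB : ℕ → ℝ → ι → ℝ}
  {Bad : ℕ → ℝ → Finset ι} {W Wsh δ : ℕ → ℝ}

/-! ## §1 The set-sum sandwich: every class set, whatever the bad class and the shells -/

/-- **THE SET-SUM SANDWICH** (Sketch3 §1).  The weight face, the shell face and the core face at the cores `A − shA`, `B − shB` ⇒ for every `K` ONE
constant `c` (the core's) such that for every `|t| ≤ l₀` and every `S ⊆ T K`: `Σ_S B ≤ e^{c+vol·δ_K}·Σ_S A + (W_K+Wsh_K)·Σ_T B` and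
`Σ_S A ≤ e^{−c+vol·δ_K}·Σ_S B + (W_K+Wsh_K)·Σ_T A`.  Proof: split `S` into `S ∩ Bad` (relative weight `≤ W_K`) and `S ∖ Bad` (write `B = (B − shB) + shB`,
core sandwich termwise, `0 ≤ sh`, total shell `≤ Wsh_K`). [folklore] -/
theorem setSum_sandwich (hW : RelWeightBound l₀ T A B Bad W) (hSh : ShellWeightBound l₀ T A B shA shB Wsh)
    (hcore : Core l₀ vol T Bad (fun K t τ => A K t τ - shA K t τ) (fun K t τ => B K t τ - shB K t τ) δ) (K : ℕ) :
    ∃ c : ℝ, ∀ t : ℝ, |t| ≤ l₀ → ∀ S, S ⊆ T K →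
      ∑ τ ∈ S, B K t τ ≤ Real.exp (c + vol * δ K) * ∑ τ ∈ S, A K t τ + (W K + Wsh K) * ∑ τ ∈ T K, B K t τ ∧
      ∑ τ ∈ S, A K t τ ≤ Real.exp (-c + vol * δ K) * ∑ τ ∈ S, B K t τ + (W K + Wsh K) * ∑ τ ∈ T K, A K t τ := by
  obtain ⟨c, hc⟩ := hcore K
  refine ⟨c, fun t ht S hS => ?_⟩
  have hA0 : ∀ τ ∈ T K, 0 ≤ A K t τ := fun τ hτ =>
    (hSh.sh_nonneg_left K t ht τ hτ).trans (hSh.sh_le_left K t ht τ hτ)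
  have hB0 : ∀ τ ∈ T K, 0 ≤ B K t τ := fun τ hτ =>
    (hSh.sh_nonneg_right K t ht τ hτ).trans (hSh.sh_le_right K t ht τ hτ)
  have hBadT : Bad K t ⊆ T K := hW.bad_subset K t ht
  have hsplitB := Finset.sum_inter_add_sum_sdiff S (Bad K t) (fun τ => B K t τ)
  have hsplitA := Finset.sum_inter_add_sum_sdiff S (Bad K t) (fun τ => A K t τ)
  -- the bad parts
  have hbadB : ∑ τ ∈ S ∩ Bad K t, B K t τ ≤ W K * ∑ τ ∈ T K, B K t τ :=
    (Finset.sum_le_sum_of_subset_of_nonneg Finset.inter_subset_right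
      (fun τ hτ _ => hB0 τ (hBadT hτ))).trans (hW.bad_right K t ht)
  have hbadA : ∑ τ ∈ S ∩ Bad K t, A K t τ ≤ W K * ∑ τ ∈ T K, A K t τ :=
    (Finset.sum_le_sum_of_subset_of_nonneg Finset.inter_subset_right
      (fun τ hτ _ => hA0 τ (hBadT hτ))).trans (hW.bad_left K t ht)
  -- the shells on the good part
  have hsub : S \ Bad K t ⊆ T K := Finset.sdiff_subset.trans hS
  have hshB : ∑ τ ∈ S \ Bad K t, shB K t τ ≤ Wsh K * ∑ τ ∈ T K, B K t τ :=
    (Finset.sum_le_sum_of_subset_of_nonneg hsub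
      (fun τ hτ _ => hSh.sh_nonneg_right K t ht τ hτ)).trans (hSh.right K t ht)
  have hshA : ∑ τ ∈ S \ Bad K t, shA K t τ ≤ Wsh K * ∑ τ ∈ T K, A K t τ :=
    (Finset.sum_le_sum_of_subset_of_nonneg hsub
      (fun τ hτ _ => hSh.sh_nonneg_left K t ht τ hτ)).trans (hSh.left K t ht)
  -- the good cores, termwise
  have hE : Real.exp (-c + vol * δ K) * Real.exp (c - vol * δ K) = 1 := by
    rw [← Real.exp_add]; convert Real.exp_zero using 2; ring
  have hgoodB : ∑ τ ∈ S \ Bad K t, B K t τ ≤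
      Real.exp (c + vol * δ K) * ∑ τ ∈ S \ Bad K t, A K t τ + ∑ τ ∈ S \ Bad K t, shB K t τ := by
    rw [Finset.mul_sum, ← Finset.sum_add_distrib]
    refine Finset.sum_le_sum fun τ hτ => ?_
    have hτT : τ ∈ T K := hsub hτ
    have hτgood : τ ∈ T K \ Bad K t := Finset.mem_sdiff.2 ⟨hτT, (Finset.mem_sdiff.1 hτ).2⟩
    have h2 := (hc t ht τ hτgood).2
    have := mul_nonneg (Real.exp_pos (c + vol * δ K)).le (hSh.sh_nonneg_left K t ht τ hτT)
    linarith
  have hgoodA : ∑ τ ∈ S \ Bad K t, A K t τ ≤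
      Real.exp (-c + vol * δ K) * ∑ τ ∈ S \ Bad K t, B K t τ + ∑ τ ∈ S \ Bad K t, shA K t τ := by
    rw [Finset.mul_sum, ← Finset.sum_add_distrib]
    refine Finset.sum_le_sum fun τ hτ => ?_
    have hτT : τ ∈ T K := hsub hτ
    have hτgood : τ ∈ T K \ Bad K t := Finset.mem_sdiff.2 ⟨hτT, (Finset.mem_sdiff.1 hτ).2⟩
    have h1 := (hc t ht τ hτgood).1
    have h1' : A K t τ - shA K t τ ≤ Real.exp (-c + vol * δ K) * (B K t τ - shB K t τ) := by
      have := mul_le_mul_of_nonneg_left h1 (Real.exp_pos (-c + vol * δ K)).le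
      rwa [← mul_assoc, hE, one_mul] at this
    have := mul_nonneg (Real.exp_pos (-c + vol * δ K)).le (hSh.sh_nonneg_right K t ht τ hτT)
    linarith
  -- monotonicity of the good sums in `S ∖ Bad ⊆ S`
  have hmonoA : Real.exp (c + vol * δ K) * ∑ τ ∈ S \ Bad K t, A K t τ ≤ Real.exp (c + vol * δ K) * ∑ τ ∈ S, A K t τ :=
    mul_le_mul_of_nonneg_left (Finset.sum_le_sum_of_subset_of_nonneg Finset.sdiff_subset
      (fun τ hτ _ => hA0 τ (hS hτ))) (Real.exp_pos _).le
  have hmonoB : Real.exp (-c + vol * δ K) * ∑ τ ∈ S \ Bad K t, B K t τ ≤ Real.exp (-c + vol * δ K) * ∑ τ ∈ S, B K t τ :=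
    mul_le_mul_of_nonneg_left (Finset.sum_le_sum_of_subset_of_nonneg Finset.sdiff_subset
      (fun τ hτ _ => hB0 τ (hS hτ))) (Real.exp_pos _).le
  have hdB : (W K + Wsh K) * ∑ τ ∈ T K, B K t τ = W K * ∑ τ ∈ T K, B K t τ + Wsh K * ∑ τ ∈ T K, B K t τ := add_mul _ _ _
  have hdA : (W K + Wsh K) * ∑ τ ∈ T K, A K t τ = W K * ∑ τ ∈ T K, A K t τ + Wsh K * ∑ τ ∈ T K, A K t τ := add_mul _ _ _
  constructor <;> linarith

/-! ## §2 The class laws merge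

The normalised CLASS LAW of run `X` at `(K, t)` is `S ↦ (Σ_{τ ∈ S} X K t τ) ∕ Σ_{τ ∈ T K} X K t τ`; the MERGE SLOPE is `M_K = e^{2|vol·δ_K|} ∕ (1 − (W_K + Wsh_K))` and the MERGE RADIUS
`ρ_K = (M_K − 1) + (W_K + Wsh_K)` — all three spelled inline below (the sketch's `classLaw`, `slope`, `rho`). -/

/-- **AFFINE DOMINATION OF THE CLASS LAWS** (Sketch3 §2).  Under the three faces, at every `(K, t)` with `W_K + Wsh_K < 1` and a positive run-A total, for every
`S ⊆ T K`: the run-B total is positive, `μ_B(S) ≤ M_K·μ_A(S) + ε_K` and `μ_A(S) ≤ M_K·μ_B(S) + ε_K` (`ε_K = W_K + Wsh_K`, `M_K = e^{2|vol·δ_K|} ∕ (1 − ε_K)`).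
Single-step and unbundled: `ε_K < 1` is needed at THIS `K` only (the bundled `HybridNE7` edition is dag-n20-w4's `…N20HybridClassLawBudget`, p607565). [folklore] -/
theorem classLaw_le_of_faces (hW : RelWeightBound l₀ T A B Bad W) (hSh : ShellWeightBound l₀ T A B shA shB Wsh)
    (hcore : Core l₀ vol T Bad (fun K t τ => A K t τ - shA K t τ) (fun K t τ => B K t τ - shB K t τ) δ)
    {K : ℕ} (hε : W K + Wsh K < 1) {t : ℝ} (ht : |t| ≤ l₀) (hZA : 0 < ∑ τ ∈ T K, A K t τ) {S : Finset ι} (hS : S ⊆ T K) :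
    0 < ∑ τ ∈ T K, B K t τ ∧
    (∑ τ ∈ S, B K t τ) / (∑ τ ∈ T K, B K t τ) ≤
      Real.exp (2 * |vol * δ K|) / (1 - (W K + Wsh K)) * ((∑ τ ∈ S, A K t τ) / ∑ τ ∈ T K, A K t τ) + (W K + Wsh K) ∧
    (∑ τ ∈ S, A K t τ) / (∑ τ ∈ T K, A K t τ) ≤
      Real.exp (2 * |vol * δ K|) / (1 - (W K + Wsh K)) * ((∑ τ ∈ S, B K t τ) / ∑ τ ∈ T K, B K t τ) + (W K + Wsh K) := by
  obtain ⟨c, hc⟩ := setSum_sandwich hW hSh hcore K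
  have hA0 : ∀ τ ∈ T K, 0 ≤ A K t τ := fun τ hτ =>
    (hSh.sh_nonneg_left K t ht τ hτ).trans (hSh.sh_le_left K t ht τ hτ)
  have hB0 : ∀ τ ∈ T K, 0 ≤ B K t τ := fun τ hτ =>
    (hSh.sh_nonneg_right K t ht τ hτ).trans (hSh.sh_le_right K t ht τ hτ)
  set η := vol * δ K with hη
  set ε := W K + Wsh K with hεdef
  set ZA := ∑ τ ∈ T K, A K t τ with hZAdef
  set ZB := ∑ τ ∈ T K, B K t τ with hZBdef
  set sA := ∑ τ ∈ S, A K t τ with hsAdef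
  set sB := ∑ τ ∈ S, B K t τ with hsBdef
  have h1ε : 0 < 1 - ε := by linarith
  obtain ⟨hST_B, hST_A⟩ := hc t ht (T K) subset_rfl
  obtain ⟨hS_B, hS_A⟩ := hc t ht S hS
  have hsA0 : 0 ≤ sA := Finset.sum_nonneg fun τ hτ => hA0 τ (hS hτ)
  have hsB0 : 0 ≤ sB := Finset.sum_nonneg fun τ hτ => hB0 τ (hS hτ)
  -- totals: `(1 − ε)·ZA ≤ e^{−c+η}·ZB`, `(1 − ε)·ZB ≤ e^{c+η}·ZA`; positivity of `ZB`
  have hTA : (1 - ε) * ZA ≤ Real.exp (-c + η) * ZB := by nlinarith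
  have hTB : (1 - ε) * ZB ≤ Real.exp (c + η) * ZA := by nlinarith
  have hZB : 0 < ZB := by
    have h : Real.exp (-c + η) * 0 < Real.exp (-c + η) * ZB := by
      rw [mul_zero]; exact lt_of_lt_of_le (mul_pos h1ε hZA) hTA
    exact lt_of_mul_lt_mul_left h (Real.exp_pos _).le
  refine ⟨hZB, ?_, ?_⟩
  · -- `e^{c+η} ≤ e^{2|η|}·ZB ∕ ((1−ε)·ZA)`
    have key : Real.exp (c + η) * ((1 - ε) * ZA) ≤ Real.exp (2 * |η|) * ZB := by
      calc Real.exp (c + η) * ((1 - ε) * ZA)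
          ≤ Real.exp (c + η) * (Real.exp (-c + η) * ZB) := mul_le_mul_of_nonneg_left hTA (Real.exp_pos _).le
        _ = Real.exp (2 * η) * ZB := by rw [← mul_assoc, ← Real.exp_add]; ring_nf
        _ ≤ Real.exp (2 * |η|) * ZB :=
          mul_le_mul_of_nonneg_right (Real.exp_le_exp.2 (by linarith [le_abs_self η])) hZB.le
    have key' : Real.exp (c + η) ≤ Real.exp (2 * |η|) * ZB / ((1 - ε) * ZA) :=
      (le_div_iff₀ (mul_pos h1ε hZA)).2 key
    have h3 : sB ≤ Real.exp (2 * |η|) * ZB / ((1 - ε) * ZA) * sA + ε * ZB :=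
      hS_B.trans (by nlinarith [mul_le_mul_of_nonneg_right key' hsA0])
    rw [div_le_iff₀ hZB]
    calc sB ≤ Real.exp (2 * |η|) * ZB / ((1 - ε) * ZA) * sA + ε * ZB := h3
      _ = (Real.exp (2 * |η|) / (1 - ε) * (sA / ZA) + ε) * ZB := by
        field_simp
  · have key : Real.exp (-c + η) * ((1 - ε) * ZB) ≤ Real.exp (2 * |η|) * ZA := by
      calc Real.exp (-c + η) * ((1 - ε) * ZB)
          ≤ Real.exp (-c + η) * (Real.exp (c + η) * ZA) := mul_le_mul_of_nonneg_left hTB (Real.exp_pos _).le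
        _ = Real.exp (2 * η) * ZA := by rw [← mul_assoc, ← Real.exp_add]; ring_nf
        _ ≤ Real.exp (2 * |η|) * ZA :=
          mul_le_mul_of_nonneg_right (Real.exp_le_exp.2 (by linarith [le_abs_self η])) hZA.le
    have key' : Real.exp (-c + η) ≤ Real.exp (2 * |η|) * ZA / ((1 - ε) * ZB) :=
      (le_div_iff₀ (mul_pos h1ε hZB)).2 key
    have h3 : sA ≤ Real.exp (2 * |η|) * ZA / ((1 - ε) * ZB) * sB + ε * ZA :=
      hS_A.trans (by nlinarith [mul_le_mul_of_nonneg_right key' hsB0])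
    rw [div_le_iff₀ hZA]
    calc sA ≤ Real.exp (2 * |η|) * ZA / ((1 - ε) * ZB) * sB + ε * ZA := h3
      _ = (Real.exp (2 * |η|) / (1 - ε) * (sB / ZB) + ε) * ZA := by
        field_simp

omit [DecidableEq ι] in
/-- A class law takes values in `[0, 1]` (nonnegative weights on `T K`, positive total, `S ⊆ T K`). [folklore] -/
theorem classLaw_mem_unitInterval {X : ℕ → ℝ → ι → ℝ} {K : ℕ} {t : ℝ} (hX : ∀ τ ∈ T K, 0 ≤ X K t τ) (hZ : 0 < ∑ τ ∈ T K, X K t τ)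
    {S : Finset ι} (hS : S ⊆ T K) :
    0 ≤ (∑ τ ∈ S, X K t τ) / (∑ τ ∈ T K, X K t τ) ∧ (∑ τ ∈ S, X K t τ) / (∑ τ ∈ T K, X K t τ) ≤ 1 := by
  refine ⟨div_nonneg (Finset.sum_nonneg fun τ hτ => hX τ (hS hτ)) hZ.le, ?_⟩
  exact (div_le_one hZ).2 (Finset.sum_le_sum_of_subset_of_nonneg hS fun τ hτ _ => hX τ hτ)

/-- The merge slope `e^{2|vol·δ_K|} ∕ (1 − (W_K + Wsh_K))` is at least one when `W_K + Wsh_K ∈ [0, 1)`. [folklore] -/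
theorem one_le_slope {K : ℕ} (hε0 : 0 ≤ W K + Wsh K) (hε : W K + Wsh K < 1) :
    1 ≤ Real.exp (2 * |vol * δ K|) / (1 - (W K + Wsh K)) := by
  refine (one_le_div (by linarith)).2 ?_
  have : (1 : ℝ) ≤ Real.exp (2 * |vol * δ K|) := Real.one_le_exp (by positivity)
  linarith

/-- **THE CLASS LAWS MERGE IN TOTAL VARIATION, ONE STEP** (Sketch3 §2).  Under the three faces, at every `(K, t)` with `W_K + Wsh_K < 1` and a positive run-A total:
`|μ_B(S) − μ_A(S)| ≤ ρ_K = (e^{2|vol·δ_K|} ∕ (1 − (W_K + Wsh_K)) − 1) + (W_K + Wsh_K)` for every `S ⊆ T K`. [folklore] -/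
theorem abs_classLaw_sub_le_of_faces (hW : RelWeightBound l₀ T A B Bad W) (hSh : ShellWeightBound l₀ T A B shA shB Wsh)
    (hcore : Core l₀ vol T Bad (fun K t τ => A K t τ - shA K t τ) (fun K t τ => B K t τ - shB K t τ) δ)
    {K : ℕ} (hε : W K + Wsh K < 1) {t : ℝ} (ht : |t| ≤ l₀) (hZA : 0 < ∑ τ ∈ T K, A K t τ) {S : Finset ι} (hS : S ⊆ T K) :
    |(∑ τ ∈ S, B K t τ) / (∑ τ ∈ T K, B K t τ) - (∑ τ ∈ S, A K t τ) / (∑ τ ∈ T K, A K t τ)| ≤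
      (Real.exp (2 * |vol * δ K|) / (1 - (W K + Wsh K)) - 1) + (W K + Wsh K) := by
  obtain ⟨hZB, hBA, hAB⟩ := classLaw_le_of_faces hW hSh hcore hε ht hZA hS
  have hA0 : ∀ τ ∈ T K, 0 ≤ A K t τ := fun τ hτ =>
    (hSh.sh_nonneg_left K t ht τ hτ).trans (hSh.sh_le_left K t ht τ hτ)
  have hB0 : ∀ τ ∈ T K, 0 ≤ B K t τ := fun τ hτ =>
    (hSh.sh_nonneg_right K t ht τ hτ).trans (hSh.sh_le_right K t ht τ hτ)
  obtain ⟨hμA0, hμA1⟩ := classLaw_mem_unitInterval hA0 hZA hS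
  obtain ⟨hμB0, hμB1⟩ := classLaw_mem_unitInterval hB0 hZB hS
  have hε0 : 0 ≤ W K + Wsh K := add_nonneg (hW.nonneg K) (hSh.nonneg K)
  have hM := one_le_slope (vol := vol) (δ := δ) hε0 hε
  rw [abs_sub_le_iff]
  constructor
  · nlinarith
  · nlinarith

/-- `ρ_K → 0`: the widths `vol·δ_K` and the weights `W_K`, `Wsh_K` are summable, hence null. [folklore] -/
theorem tendsto_rho (hδ : Summable δ) (hW : Summable W) (hWsh : Summable Wsh) :
    Tendsto (fun K => (Real.exp (2 * |vol * δ K|) / (1 - (W K + Wsh K)) - 1) + (W K + Wsh K)) atTop (𝓝 0) := by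
  have hε : Tendsto (fun K => W K + Wsh K) atTop (𝓝 0) := by
    simpa using hW.tendsto_atTop_zero.add hWsh.tendsto_atTop_zero
  have hη : Tendsto (fun K => 2 * |vol * δ K|) atTop (𝓝 0) := by
    simpa using ((hδ.tendsto_atTop_zero.const_mul vol).abs).const_mul 2
  have hexp : Tendsto (fun K => Real.exp (2 * |vol * δ K|)) atTop (𝓝 1) := by
    have h := (Real.continuous_exp.tendsto 0).comp hη
    rw [Real.exp_zero] at h
    exact h
  have h1ε : Tendsto (fun K => 1 - (W K + Wsh K)) atTop (𝓝 1) := by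
    have h := (tendsto_const_nhds (x := (1 : ℝ)) (f := (atTop : Filter ℕ))).sub hε
    rw [sub_zero] at h
    exact h
  have hM : Tendsto (fun K => Real.exp (2 * |vol * δ K|) / (1 - (W K + Wsh K))) atTop (𝓝 1) := by
    have h := hexp.div h1ε one_ne_zero
    rw [div_one] at h
    exact h
  have h := (hM.sub (tendsto_const_nhds (x := (1 : ℝ)))).add hε
  rw [sub_self, add_zero] at h
  exact h

/-- ★ **THE LAW MERGE, POSITIVE FORM.**  The three faces with `Summable δ` and positive run-A totals on the window ⇒ for every `s > 0`, for all large `K`, every `|t| ≤ l₀`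
and every `S ⊆ T K`: `|μ_B(S) − μ_A(S)| < s` — the two runs' across-class laws merge uniformly in `(t, S)`.  No `lt_one` letter: `W_K + Wsh_K < 1` eventually, from
the summabilities the weight and shell faces carry. [folklore] -/
theorem lawMerge_of_faces (hW : RelWeightBound l₀ T A B Bad W) (hSh : ShellWeightBound l₀ T A B shA shB Wsh)
    (hcore : Core l₀ vol T Bad (fun K t τ => A K t τ - shA K t τ) (fun K t τ => B K t τ - shB K t τ) δ) (hδ : Summable δ)
    (hpos : ∀ K t, |t| ≤ l₀ → 0 < ∑ τ ∈ T K, A K t τ) {s : ℝ} (hs : 0 < s) :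
    ∀ᶠ K in atTop, ∀ t : ℝ, |t| ≤ l₀ → ∀ S, S ⊆ T K →
      |(∑ τ ∈ S, B K t τ) / (∑ τ ∈ T K, B K t τ) - (∑ τ ∈ S, A K t τ) / (∑ τ ∈ T K, A K t τ)| < s := by
  have hρ := tendsto_rho (vol := vol) hδ hW.summable hSh.summable
  have hε : Tendsto (fun K => W K + Wsh K) atTop (𝓝 0) := by
    simpa using hW.summable.tendsto_atTop_zero.add hSh.summable.tendsto_atTop_zero
  filter_upwards [hρ.eventually (gt_mem_nhds hs), hε.eventually (gt_mem_nhds one_pos)] with K hρK hεK t ht S hS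
  exact lt_of_le_of_lt (abs_classLaw_sub_le_of_faces hW hSh hcore hεK ht (hpos K t ht) hS) hρK

/-! ## §3 No dial rescues a law-separated pair

LAW SEPARATION of `(T, A, B)` at size `s` on the window `|t| ≤ l₀` — the sketch's `LawSeparated l₀ T A B s`, spelled inline below — reads: for every `K₀` there are `K ≥ K₀`,
a source `|t| ≤ l₀` and a class set `S ⊆ T K` on which run B's class law exceeds run A's by at least `s` (one-sided is general: pass to the complement).  At the record this is
the card's letter N1 (LS) — NOT decided here. -/

/-- ★★ **NO DIAL RESCUES** (Sketch3 §3).  If the class laws of `(T, A, B)` are `s`-separated (`s > 0`) on the window and run A's totals are positive there, then for NO bad-class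
family `Bad`, NO weights `W`, NO shells `shA, shB`, NO shell weights `Wsh` and NO widths `δ` do the three faces of K3⁷ v5 stub 2 hold together:
`¬ ∃ …, RelWeightBound ∧ ShellWeightBound ∧ (Core on the cores ∧ Summable δ)` — the EXACT face triple, no `lt_one` letter.  At the pinned carriers of `PinnedAtLive` this
covers the cut dial `jc` (it moves only `Bad`, `W`) and the shell dial `sh` (it moves only `shA, shB, Wsh`) simultaneously. [folklore] -/
theorem no_dial_rescues {s : ℝ} (hs : 0 < s)
    (hsep : ∀ K₀ : ℕ, ∃ K, K₀ ≤ K ∧ ∃ t : ℝ, |t| ≤ l₀ ∧ ∃ S, S ⊆ T K ∧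
      s ≤ (∑ τ ∈ S, B K t τ) / (∑ τ ∈ T K, B K t τ) - (∑ τ ∈ S, A K t τ) / (∑ τ ∈ T K, A K t τ))
    (hpos : ∀ K t, |t| ≤ l₀ → 0 < ∑ τ ∈ T K, A K t τ) :
    ¬ ∃ (Bad : ℕ → ℝ → Finset ι) (W : ℕ → ℝ) (shA shB : ℕ → ℝ → ι → ℝ) (Wsh δ : ℕ → ℝ),
      RelWeightBound l₀ T A B Bad W ∧ ShellWeightBound l₀ T A B shA shB Wsh ∧
      (Core l₀ vol T Bad (fun K t τ => A K t τ - shA K t τ) (fun K t τ => B K t τ - shB K t τ) δ ∧ Summable δ) := by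
  rintro ⟨Bad, W, shA, shB, Wsh, δ, hW, hSh, hcore, hδ⟩
  obtain ⟨K₀, hK₀⟩ := (lawMerge_of_faces (vol := vol) hW hSh hcore hδ hpos hs).exists_forall_of_atTop
  obtain ⟨K, hK, t, ht, S, hS, hsKS⟩ := hsep K₀
  have h := hK₀ K hK t ht S hS
  linarith [le_abs_self ((∑ τ ∈ S, B K t τ) / (∑ τ ∈ T K, B K t τ) - (∑ τ ∈ S, A K t τ) / (∑ τ ∈ T K, A K t τ))]

/-- ★ The same for the hybrid binder list `T4MatchingAssembly.HybridNE7` (whose `weight ∕ shell ∕ core ∕ summable` fields are the three faces; its `lt_one` is not even used).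
The bundled unsummable-gap edition is dag-n20-w4's `N20HybridClassLawBudget.not_exists_hybridNE7_of_unsummable_classLawGap` (p607565). [folklore] -/
theorem not_hybridNE7_of_lawSeparated {s : ℝ} (hs : 0 < s)
    (hsep : ∀ K₀ : ℕ, ∃ K, K₀ ≤ K ∧ ∃ t : ℝ, |t| ≤ l₀ ∧ ∃ S, S ⊆ T K ∧
      s ≤ (∑ τ ∈ S, B K t τ) / (∑ τ ∈ T K, B K t τ) - (∑ τ ∈ S, A K t τ) / (∑ τ ∈ T K, A K t τ))
    (hpos : ∀ K t, |t| ≤ l₀ → 0 < ∑ τ ∈ T K, A K t τ) :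
    ¬ ∃ (Bad : ℕ → ℝ → Finset ι) (W : ℕ → ℝ) (shA shB : ℕ → ℝ → ι → ℝ) (Wsh δ : ℕ → ℝ),
      HybridNE7 l₀ vol T A B Bad W shA shB Wsh δ := by
  rintro ⟨Bad, W, shA, shB, Wsh, δ, h⟩
  exact no_dial_rescues (vol := vol) hs hsep hpos ⟨Bad, W, shA, shB, Wsh, δ, h.weight, h.shell, core_of_hybridNE7 h, h.summable⟩

/-- ★ QUANTITATIVE ONE-STEP FORM (the disprover's dial-free handle): under the three faces the separation at step `K` (with `W_K + Wsh_K < 1`, positive run-A total) is at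
most `ρ_K` — so a producer of the faces with rates `(δ, W, Wsh)` is refuted by ONE `(K, t, S)` with `μ_B(S) − μ_A(S) > ρ_K`. [folklore] -/
theorem separation_le_rho (hW : RelWeightBound l₀ T A B Bad W) (hSh : ShellWeightBound l₀ T A B shA shB Wsh)
    (hcore : Core l₀ vol T Bad (fun K t τ => A K t τ - shA K t τ) (fun K t τ => B K t τ - shB K t τ) δ)
    {K : ℕ} (hε : W K + Wsh K < 1) {t : ℝ} (ht : |t| ≤ l₀) (hZA : 0 < ∑ τ ∈ T K, A K t τ) {S : Finset ι} (hS : S ⊆ T K) :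
    (∑ τ ∈ S, B K t τ) / (∑ τ ∈ T K, B K t τ) - (∑ τ ∈ S, A K t τ) / (∑ τ ∈ T K, A K t τ) ≤
      (Real.exp (2 * |vol * δ K|) / (1 - (W K + Wsh K)) - 1) + (W K + Wsh K) :=
  (le_abs_self _).trans (abs_classLaw_sub_le_of_faces hW hSh hcore hε ht hZA hS)

/-! ## §4 Non-vacuity and target-compatibility: a two-class toy

Two classes `{0, 1} = Finset.range 2` at every step; run A gives both weight `4^K`, run B gives weight `(2 + 4n)·4^K` to class `n` (so `2·4^K` and `6·4^K`);
partition functions `Z_K = 2·4^K`.  All spelled inline as lambdas (no `def`). -/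

/-- The toy's run-A total is `2·4^K`. [folklore] -/
theorem sum_toyA (K : ℕ) : ∑ _n ∈ Finset.range 2, (4 : ℝ) ^ K = 2 * 4 ^ K := by
  rw [Finset.sum_range_succ, Finset.sum_range_succ, Finset.sum_range_zero]; ring

/-- The toy's run-B total is `8·4^K`. [folklore] -/
theorem sum_toyB (K : ℕ) : ∑ n ∈ Finset.range 2, (2 + 4 * (n : ℝ)) * 4 ^ K = 8 * 4 ^ K := by
  rw [Finset.sum_range_succ, Finset.sum_range_succ, Finset.sum_range_zero]; push_cast; ring

/-- The toy's class laws are `1∕4`-separated on `S = {1}` at every step (`μ_A = 1∕2`, `μ_B = 3∕4`), any window `0 ≤ l₀` (source `t = 0`) — the (LS) hypothesis of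
`no_dial_rescues` at `T := fun _ => range 2`, `A := fun K _ _ => 4^K`, `B := fun K _ n => (2 + 4n)·4^K`, `s := 1∕4`. [folklore] -/
theorem toy_lawSeparated (hl₀ : 0 ≤ l₀) :
    ∀ K₀ : ℕ, ∃ K, K₀ ≤ K ∧ ∃ t : ℝ, |t| ≤ l₀ ∧ ∃ S, S ⊆ Finset.range 2 ∧
      (1 : ℝ) / 4 ≤ (∑ n ∈ S, (2 + 4 * (n : ℝ)) * 4 ^ K) / (∑ n ∈ Finset.range 2, (2 + 4 * (n : ℝ)) * 4 ^ K) -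
        (∑ _n ∈ S, (4 : ℝ) ^ K) / (∑ _n ∈ Finset.range 2, (4 : ℝ) ^ K) := by
  intro K₀
  refine ⟨K₀, le_rfl, 0, by simpa using hl₀, {1}, Finset.singleton_subset_iff.2 (Finset.mem_range.2 (by norm_num)), ?_⟩
  have eB : (∑ n ∈ ({1} : Finset ℕ), (2 + 4 * (n : ℝ)) * 4 ^ K₀) / (∑ n ∈ Finset.range 2, (2 + 4 * (n : ℝ)) * 4 ^ K₀) = 3 / 4 := by
    rw [sum_toyB, Finset.sum_singleton, div_eq_div_iff (by positivity) (by norm_num)]; push_cast; ring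
  have eA : (∑ _n ∈ ({1} : Finset ℕ), (4 : ℝ) ^ K₀) / (∑ _n ∈ Finset.range 2, (4 : ℝ) ^ K₀) = 1 / 2 := by
    rw [sum_toyA, Finset.sum_singleton, div_eq_div_iff (by positivity) (by norm_num)]; ring
  rw [eB, eA]; norm_num

/-- ★ NON-VACUITY of §3: in the toy NO dial (`Bad`, `W`, shells, `Wsh`, `δ`, for any `vol`) delivers the three faces of stub 2. [folklore] -/
theorem toy_no_dial (hl₀ : 0 ≤ l₀) (vol : ℝ) :
    ¬ ∃ (Bad : ℕ → ℝ → Finset ℕ) (W : ℕ → ℝ) (shA shB : ℕ → ℝ → ℕ → ℝ) (Wsh δ : ℕ → ℝ),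
      RelWeightBound l₀ (fun _ : ℕ => Finset.range 2) (fun (K : ℕ) (_ : ℝ) (_ : ℕ) => (4 : ℝ) ^ K)
          (fun (K : ℕ) (_ : ℝ) (n : ℕ) => (2 + 4 * (n : ℝ)) * 4 ^ K) Bad W ∧
        ShellWeightBound l₀ (fun _ : ℕ => Finset.range 2) (fun (K : ℕ) (_ : ℝ) (_ : ℕ) => (4 : ℝ) ^ K)
          (fun (K : ℕ) (_ : ℝ) (n : ℕ) => (2 + 4 * (n : ℝ)) * 4 ^ K) shA shB Wsh ∧
        (Core l₀ vol (fun _ : ℕ => Finset.range 2) Bad (fun K t n => (4 : ℝ) ^ K - shA K t n)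
            (fun K t n => (2 + 4 * (n : ℝ)) * 4 ^ K - shB K t n) δ ∧ Summable δ) :=
  no_dial_rescues (T := fun _ : ℕ => Finset.range 2) (A := fun (K : ℕ) (_ : ℝ) (_ : ℕ) => (4 : ℝ) ^ K)
    (B := fun (K : ℕ) (_ : ℝ) (n : ℕ) => (2 + 4 * (n : ℝ)) * 4 ^ K) (by norm_num) (toy_lawSeparated hl₀)
    (fun K _ _ => by simp only [sum_toyA]; positivity)

/-- ★ TARGET-COMPATIBILITY: the toy's partition functions `Z_K := 2·4^K` satisfy node U5's DECL target `Spine.NE7.Target vol l₀ 0 Z` EXACTLY (constant `log 4`, width `0`),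
and `Z` IS the toy's dictionary (`Z_K = Σ A_K`, `Z_{K+1} = Σ B_K`) — so (by `toy_no_dial`) the target holds while NO hybrid certificate exists: the hybrid road asks more than the
target (dag-n19-w1 `…N19HybridBeyondTarget`, p602850), here with every dial free. [folklore] -/
theorem toy_target (vol l₀ : ℝ) :
    Target vol l₀ (fun _ => 0) (fun (K : ℕ) (_ : ℝ) => 2 * (4 : ℝ) ^ K) ∧
      (∀ K : ℕ, (2 : ℝ) * 4 ^ K = ∑ _n ∈ Finset.range 2, (4 : ℝ) ^ K) ∧
      (∀ K : ℕ, (2 : ℝ) * 4 ^ (K + 1) = ∑ n ∈ Finset.range 2, (2 + 4 * (n : ℝ)) * 4 ^ K) := by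
  refine ⟨⟨fun K => ⟨Real.log 4, fun _ _ => ?_⟩, summable_zero⟩, fun K => by rw [sum_toyA], fun K => by rw [sum_toyB]; ring⟩
  show |Real.log (2 * (4 : ℝ) ^ (K + 1)) - Real.log (2 * (4 : ℝ) ^ K) - Real.log 4| ≤ vol * 0
  rw [show (2 : ℝ) * 4 ^ (K + 1) = 4 * (2 * 4 ^ K) by ring, Real.log_mul (by norm_num) (by positivity)]
  ring_nf
  simp

end Summit.QuantumFields.YangMills.BalabanUVNodes.N19NoDialRescuesLawSeparated
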